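import Literature.NumberTheory.QuadraticFields.ThreeTorsionMean
import Mathlib.NumberTheory.ArithmeticFunction.Moebius
import Mathlib.NumberTheory.LSeries.Dirichlet
import Mathlib.NumberTheory.ZetaValues
import Mathlib.Analysis.PSeries
import Mathlib.Data.Nat.Squarefree
import HarnessLib

/-!
# Counting quadratic fields: `#{fundamental discriminants 0 < ±D < X} = (3/π²) X + O(√X)` (proofs)

A `…Proofs` companion (theorems only: no definition, no named fact, no instance; D-0026) of
`Literature.NumberTheory.QuadraticFields.ThreeTorsionMean`, the file vendoring
Bhargava–Taniguchi–Thorne 2023, Thm 1.2 (`btt_threeTorsion_sum`) and Davenport–Heilbronn /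
Bhargava–Shankar–Tsimerman Cor. 7 (`bst_threeTorsion_mean`).

In the printed proof of BTT Thm 1.2 (arXiv:2107.12819, p. 3 and §5) the sum
`Σ_{0<±D<X} #Cl(ℚ(√D))[3]` is `N₂^±(X) + 2 N^±_{3,fund}(X)`, where `N₂^±(X)` is the number of
quadratic fields `F` with `0 < ±Disc(F) < X`, i.e. of fundamental discriminants in that range, and
`N₂^±(X) = (3/π²) X + O(X^{1/2})` is their Prop. 4.2 (with no local conditions; proved in their §8 by
counting squarefree integers in arithmetic progressions; Taniguchi–Thorne 2013, Lemma 21 at `m = 1`).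
This file PROVES that quadratic-field count for the tree's finsets `posFundDiscrs X`,
`negFundDiscrs X` of `ThreeTorsionMean.lean`, with an explicit constant:

* `abs_card_squarefree_mod_four_sub_le` — for `a ∈ {1, 2, 3}`:
  `|#{1 ≤ n ≤ N : n squarefree, n ≡ a (mod 4)} − (2/π²) N| ≤ 3 √N`
  (Möbius: `𝟙_{sqfree}(n) = Σ_{d² ∣ n} μ(d)`, only odd `d` occur, `Σ_{d odd} μ(d)/d² = 8/π²`);
* `abs_card_posFundDiscrs_sub_le`, `abs_card_negFundDiscrs_sub_le` —
  **`|#{0 < ±D < X fundamental} − (3/π²) X| ≤ 8 √X`** for every `X : ℕ`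
  (BTT Prop. 4.2 / §8 with `Σ` trivial: `D ≡ 1 (4)` squarefree, or `D = 4d`, `d ≡ 2, 3 (4)`
  squarefree, so `N₂^± = S₁ + S₂ + S₃` with the three residue-class counts above at `X` and `X/4`);
* `bst_threeTorsion_mean_of_btt_threeTorsion_sum` — the vendored constants are consistent:
  BTT Thm 1.2 (`btt_threeTorsion_sum`: sums `(6/π²) X`, `(4/π²) X` up to `O(X^{5/6})`) together
  with the PROVED counts gives the Davenport–Heilbronn means `2` and `4/3`
  (`bst_threeTorsion_mean`), since `(6/π²)/(3/π²) = 2` and `(4/π²)/(3/π²) = 4/3`.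

Everything here is proved; `btt_threeTorsion_sum` itself (Shintani zeta functions, Landau's
method, the Davenport–Heilbronn sieve and the class-field-theory dictionary with cubic fields) is
not touched.

## References

* M. Bhargava, T. Taniguchi, F. Thorne, *Improved error estimates for the Davenport–Heilbronn
  theorems*, Math. Ann. 389 (2024) = arXiv:2107.12819, Thm 1.2 (p. 3), Prop. 4.2, §8
  [BhargavaTaniguchiThorne2023].
* T. Taniguchi, F. Thorne, *Secondary terms in counting functions for cubic fields*, Duke Math. J.
  162 (2013), Lemma 21 [TaniguchiThorne2013].

## Mathlib / tree search

`ArithmeticFunction.moebius_mul_coe_zeta`, `ArithmeticFunction.coe_mul_zeta_apply`,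
`Nat.sq_mul_squarefree_of_pos`, `ArithmeticFunction.LSeries_zeta_mul_Lseries_moebius`,
`ArithmeticFunction.LSeries_zeta_eq_riemannZeta`, `riemannZeta_two`, `tsum_even_add_odd`,
`Summable.sum_add_tsum_nat_add`, `sum_Ioc_inv_sq_le_sub`, `Nat.Ioc_filter_dvd_card_eq_div`,
`Int.squarefree_natCast`, `Int.squarefree_natAbs`. The squarefree sieve identity is also proved (in
other namespaces, under much heavier imports: Tao's log-Chowla file, Heath-Brown's cubic sieve) as
`Literature.NumberTheory.LFunctions.sqfreeInd_eq_sum_moebius`, and `∑ μ(n)/n² = 6/π²` with its tail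
as `Literature.NumberTheory.Sieve.CubicSieve.tsum_moebiusSq` / `abs_sum_moebiusSq_sub_le`; the
standard sub-steps (`d² ∣ b²a ↔ d ∣ b`, summability, the tail `Σ_{n>K} 1/n² ≤ 1/K`) are kept as
local `have`s here so that this file's imports stay inside `QuadraticFields` + Mathlib.
-/

noncomputable section

open Finset Filter
open scoped Topology ArithmeticFunction.Moebius

namespace Literature.NumberTheory.QuadraticFields

/-! ### The squarefree sieve identity `𝟙_{sqfree}(n) = Σ_{d² ∣ n} μ(d)` -/

/-- **The squarefree sieve identity**: for `1 ≤ n ≤ N`,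
`Σ_{d ≤ N, d² ∣ n} μ(d) = 𝟙_{squarefree}(n)` (write `n = b² a` with `a` squarefree; the `d` with
`d² ∣ n` are the divisors of `b`, and `Σ_{d ∣ b} μ(d) = [b = 1]`). [folklore] -/
theorem sum_moebius_filter_sq_dvd_eq {n N : ℕ} (hn : 0 < n) (hnN : n ≤ N) :
    ∑ d ∈ (Icc 1 N).filter (fun d => d ^ 2 ∣ n), (μ d : ℝ) =
      if Squarefree n then 1 else 0 := by
  obtain ⟨a, b, -, hb, hab, ha⟩ := Nat.sq_mul_squarefree_of_pos hn
  -- for `a` squarefree and `b ≥ 1`: `d² ∣ b² a ↔ d ∣ b`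
  have hiff : ∀ d : ℕ, d ^ 2 ∣ b ^ 2 * a ↔ d ∣ b := by
    intro d
    refine ⟨fun h => ?_, fun h => (pow_dvd_pow_of_dvd h 2).mul_right a⟩
    have hg : 0 < d.gcd b := Nat.gcd_pos_of_pos_right _ hb
    obtain ⟨g, d', b', hg0, hcop, rfl, rfl⟩ := Nat.exists_coprime' hg
    have h1 : d' ^ 2 ∣ b' ^ 2 * a := by
      rw [show (d' * g) ^ 2 = d' ^ 2 * g ^ 2 by ring,
        show (b' * g) ^ 2 * a = (b' ^ 2 * a) * g ^ 2 by ring] at h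
      exact (Nat.mul_dvd_mul_iff_right (pow_pos hg0 2)).1 h
    have h2 : d' ^ 2 ∣ a := (Nat.Coprime.pow 2 2 hcop).dvd_of_dvd_mul_left h1
    have h3 : d' = 1 := Nat.isUnit_iff.1 (ha d' (by simpa [sq] using h2))
    subst h3
    simp
  have hfilter : (Icc 1 N).filter (fun d => d ^ 2 ∣ n) = b.divisors := by
    ext d
    simp only [mem_filter, mem_Icc, Nat.mem_divisors]
    constructor
    · rintro ⟨-, hd⟩
      exact ⟨(hiff d).1 (hab ▸ hd), hb.ne'⟩
    · rintro ⟨hd, -⟩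
      have hd2 : d ^ 2 ∣ n := hab ▸ (hiff d).2 hd
      refine ⟨⟨Nat.pos_of_dvd_of_pos hd hb, ?_⟩, hd2⟩
      calc d ≤ d ^ 2 := Nat.le_self_pow two_ne_zero d
        _ ≤ n := Nat.le_of_dvd hn hd2
        _ ≤ N := hnN
  rw [hfilter]
  have key : ∑ d ∈ b.divisors, (μ d : ℝ) = if b = 1 then 1 else 0 := by
    have h1 := congrArg (fun f : ArithmeticFunction ℤ => f b)
      ArithmeticFunction.moebius_mul_coe_zeta
    simp only [ArithmeticFunction.coe_mul_zeta_apply, ArithmeticFunction.one_apply] at h1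
    have h2 : ((∑ d ∈ b.divisors, μ d : ℤ) : ℝ) = ((if b = 1 then 1 else 0 : ℤ) : ℝ) := by rw [h1]
    push_cast at h2
    exact h2
  rw [key]
  by_cases hb1 : b = 1
  · subst hb1
    have hna : n = a := by rw [← hab]; ring
    rw [if_pos rfl, if_pos (hna ▸ ha)]
  · have hns : ¬Squarefree n := fun hsq =>
      hb1 (Nat.isUnit_iff.1 (hsq b ⟨a, by rw [← hab]; ring⟩))
    rw [if_neg hb1, if_neg hns]

/-! ### `Σ_{d odd} μ(d)/d² = 8/π²` with the tail estimate -/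

/-- `Σ_{n ≥ 1} μ(n)/n² = 6/π²` (Mathlib: `L(ζ,2)·L(μ,2) = 1`, `ζ(2) = π²/6`; the term at `n = 0`
vanishes). [folklore] -/
theorem tsum_moebius_div_sq : ∑' n : ℕ, (μ n : ℝ) / (n : ℝ) ^ 2 = 6 / Real.pi ^ 2 := by
  have hs : 1 < (2 : ℂ).re := by norm_num
  have hzeta : LSeries (fun n => (ArithmeticFunction.zeta n : ℂ)) 2 = (Real.pi : ℂ) ^ 2 / 6 := by
    rw [ArithmeticFunction.LSeries_zeta_eq_riemannZeta hs, riemannZeta_two]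
  have hmu : LSeries (fun n => (μ n : ℂ)) 2 = 6 / (Real.pi : ℂ) ^ 2 := by
    have h := ArithmeticFunction.LSeries_zeta_mul_Lseries_moebius hs
    rw [hzeta] at h
    have hpi : (Real.pi : ℂ) ^ 2 ≠ 0 := pow_ne_zero 2 (by exact_mod_cast Real.pi_ne_zero)
    field_simp at h
    field_simp
    linear_combination h
  have hterm : ∀ n : ℕ, (((μ n : ℝ) / (n : ℝ) ^ 2 : ℝ) : ℂ) = LSeries.term (fun n => (μ n : ℂ)) 2 n := by
    intro n
    rcases eq_or_ne n 0 with rfl | hn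
    · simp [LSeries.term_zero]
    · rw [LSeries.term_of_ne_zero hn, Complex.cpow_two]
      push_cast
      rfl
  have h : ((∑' n : ℕ, (μ n : ℝ) / (n : ℝ) ^ 2 : ℝ) : ℂ) = 6 / (Real.pi : ℂ) ^ 2 := by
    rw [Complex.ofReal_tsum, ← hmu, LSeries]
    exact tsum_congr hterm
  exact_mod_cast h

/-- `|μ(n)/n²| ≤ 1/n²`. [folklore] -/
theorem abs_moebius_div_sq_le (n : ℕ) : |(μ n : ℝ) / (n : ℝ) ^ 2| ≤ 1 / (n : ℝ) ^ 2 := by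
  rw [abs_div, abs_of_nonneg (by positivity : (0 : ℝ) ≤ (n : ℝ) ^ 2)]
  refine div_le_div_of_nonneg_right ?_ (by positivity)
  exact_mod_cast ArithmeticFunction.abs_moebius_le_one

/-- `|[d odd] μ(d)/d²| ≤ 1/d²`. [folklore] -/
theorem abs_ite_moebius_div_sq_le (n : ℕ) :
    |(if n % 2 = 1 then (μ n : ℝ) / (n : ℝ) ^ 2 else 0)| ≤ 1 / (n : ℝ) ^ 2 := by
  split_ifs
  · exact abs_moebius_div_sq_le n
  · rw [abs_zero]; positivity

/-- `Σ_{d odd} μ(d)/d²` converges absolutely. [folklore] -/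
theorem summable_ite_moebius_div_sq :
    Summable fun n : ℕ => if n % 2 = 1 then (μ n : ℝ) / (n : ℝ) ^ 2 else 0 :=
  Summable.of_norm_bounded (g := fun n : ℕ => 1 / (n : ℝ) ^ 2)
    (Real.summable_one_div_nat_pow.mpr one_lt_two) fun n => by
      rw [Real.norm_eq_abs]; exact abs_ite_moebius_div_sq_le n

/-- `μ(2j)/(2j)² = -¼ · [j odd] μ(j)/j²`: for odd `j`, `μ(2j) = -μ(j)`; for even `j`, `4 ∣ 2j`
kills `μ`. [folklore] -/
theorem moebius_two_mul_div_sq (j : ℕ) :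
    (μ (2 * j) : ℝ) / ((2 * j : ℕ) : ℝ) ^ 2 =
      -(1 / 4) * (if j % 2 = 1 then (μ j : ℝ) / (j : ℝ) ^ 2 else 0) := by
  split_ifs with hj
  · have hcop : Nat.Coprime 2 j := Nat.coprime_two_left.mpr (Nat.odd_iff.mpr hj)
    rw [ArithmeticFunction.isMultiplicative_moebius.map_mul_of_coprime hcop,
      ArithmeticFunction.moebius_apply_prime Nat.prime_two]
    have hj0 : (j : ℝ) ≠ 0 := by
      have : j ≠ 0 := by rintro rfl; simp at hj
      exact_mod_cast this
    push_cast
    field_simp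
    ring
  · have hμ : μ (2 * j) = 0 := by
      rcases Nat.eq_zero_or_pos j with rfl | hjpos
      · simp
      · apply ArithmeticFunction.moebius_eq_zero_of_not_squarefree
        intro hsq
        have heven : 2 ∣ j := Nat.dvd_of_mod_eq_zero (by omega)
        obtain ⟨i, rfl⟩ := heven
        have h4 : 2 * 2 ∣ 2 * (2 * i) := mul_dvd_mul_left 2 (dvd_mul_right 2 i)
        exact absurd (Nat.isUnit_iff.mp (hsq 2 h4)) (by norm_num)
    rw [hμ]
    simp

/-- **`Σ_{d odd} μ(d)/d² = 8/π²`**: splitting `Σ_n μ(n)/n² = 6/π²` into even and odd `n`, the even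
part is `-¼` of the odd part (`moebius_two_mul_div_sq`), so the odd part is `(4/3)·(6/π²)`.
[folklore] -/
theorem tsum_ite_moebius_div_sq :
    ∑' n : ℕ, (if n % 2 = 1 then (μ n : ℝ) / (n : ℝ) ^ 2 else 0) = 8 / Real.pi ^ 2 := by
  set f : ℕ → ℝ := fun n => (μ n : ℝ) / (n : ℝ) ^ 2 with hf
  set g : ℕ → ℝ := fun n => if n % 2 = 1 then (μ n : ℝ) / (n : ℝ) ^ 2 else 0 with hg
  have hfs : Summable f :=
    Summable.of_norm_bounded (g := fun n : ℕ => 1 / (n : ℝ) ^ 2)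
      (Real.summable_one_div_nat_pow.mpr one_lt_two) fun n => by
        rw [Real.norm_eq_abs]; exact abs_moebius_div_sq_le n
  have hgs : Summable g := summable_ite_moebius_div_sq
  have h2inj : Function.Injective fun k : ℕ => 2 * k := mul_right_injective₀ two_ne_zero
  have h2inj' : Function.Injective fun k : ℕ => 2 * k + 1 :=
    fun a b h => h2inj (Nat.add_right_cancel h)
  -- even part of `f` is `-¼ Σ g`
  have heven : ∑' k, f (2 * k) = -(1 / 4) * ∑' k, g k := by
    rw [← tsum_mul_left]
    exact tsum_congr fun k => moebius_two_mul_div_sq k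
  -- odd part of `f` is the odd part of `g`, which is all of `g`
  have hodd_pt : ∀ k, f (2 * k + 1) = g (2 * k + 1) := by
    intro k
    simp only [hf, hg]
    rw [if_pos (by omega)]
  have hgeven : ∀ k, g (2 * k) = 0 := by
    intro k
    simp only [hg]
    rw [if_neg (by omega)]
  have hg_split := tsum_even_add_odd (hgs.comp_injective h2inj) (hgs.comp_injective h2inj')
  have hf_split := tsum_even_add_odd (hfs.comp_injective h2inj) (hfs.comp_injective h2inj')
  have hg0 : ∑' k, g (2 * k) = 0 := by
    rw [tsum_congr hgeven, tsum_zero]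
  have hodd : ∑' k, f (2 * k + 1) = ∑' k, g k := by
    rw [tsum_congr hodd_pt, ← hg_split, hg0, zero_add]
  have htot : ∑' k, f k = 6 / Real.pi ^ 2 := tsum_moebius_div_sq
  rw [← hf_split, heven, hodd] at htot
  change ∑' k, g k = 8 / Real.pi ^ 2
  have hpi : Real.pi ^ 2 ≠ 0 := pow_ne_zero 2 Real.pi_ne_zero
  field_simp at htot
  field_simp
  linarith

/-- **`|Σ_{d ≤ K, d odd} μ(d)/d² − 8/π²| ≤ 1/K`** (`K ≥ 1`). [folklore] -/
theorem abs_sum_ite_moebius_div_sq_sub_le {K : ℕ} (hK : 1 ≤ K) :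
    |∑ d ∈ Icc 1 K, (if d % 2 = 1 then (μ d : ℝ) / (d : ℝ) ^ 2 else 0) - 8 / Real.pi ^ 2|
      ≤ 1 / (K : ℝ) := by
  set g : ℕ → ℝ := fun n => if n % 2 = 1 then (μ n : ℝ) / (n : ℝ) ^ 2 else 0 with hg
  have hgs : Summable g := summable_ite_moebius_div_sq
  have hsplit := hgs.sum_add_tsum_nat_add (K + 1)
  rw [show ∑' k, g k = 8 / Real.pi ^ 2 from tsum_ite_moebius_div_sq] at hsplit
  have hrange : ∑ n ∈ range (K + 1), g n = ∑ n ∈ Icc 1 K, g n := by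
    rw [range_eq_Ico, sum_eq_sum_Ico_succ_bot (Nat.succ_pos K), Nat.succ_eq_add_one,
      Finset.Ico_add_one_right_eq_Icc, zero_add]
    simp [hg]
  rw [hrange] at hsplit
  have hsum_tail : Summable (fun n => g (n + (K + 1))) :=
    hgs.comp_injective (add_left_injective (K + 1))
  have hsq_tail : Summable (fun n : ℕ => 1 / ((n + (K + 1) : ℕ) : ℝ) ^ 2) :=
    (Real.summable_one_div_nat_pow.mpr one_lt_two).comp_injective (add_left_injective (K + 1))
  -- the tail `Σ_{n > K} 1/n² ≤ 1/K`
  have hsqtail : ∑' n, 1 / ((n + (K + 1) : ℕ) : ℝ) ^ 2 ≤ 1 / (K : ℝ) := by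
    refine Real.tsum_le_of_sum_range_le (fun n => by positivity) fun N => ?_
    have hshift : ∑ i ∈ range N, 1 / (((i + (K + 1) : ℕ) : ℝ)) ^ 2 =
        ∑ j ∈ Ioc K (K + N), ((j : ℝ) ^ 2)⁻¹ := by
      rw [← Finset.Ico_add_one_add_one_eq_Ioc, Finset.sum_Ico_eq_sum_range]
      simp only [show K + N + 1 - (K + 1) = N by omega, one_div]
      refine sum_congr rfl fun i _ => ?_
      congr 2
      push_cast
      ring
    rw [hshift]
    rcases Nat.eq_zero_or_pos N with rfl | hN
    · simp
    calc ∑ j ∈ Ioc K (K + N), ((j : ℝ) ^ 2)⁻¹ ≤ (K : ℝ)⁻¹ - ((K + N : ℕ) : ℝ)⁻¹ :=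
          sum_Ioc_inv_sq_le_sub (by omega) (Nat.le_add_right K N)
      _ ≤ 1 / (K : ℝ) := by
          rw [one_div]
          have : (0 : ℝ) ≤ ((K + N : ℕ) : ℝ)⁻¹ := by positivity
          linarith
  have htail : |∑' n, g (n + (K + 1))| ≤ 1 / (K : ℝ) := by
    calc |∑' n, g (n + (K + 1))| = ‖∑' n, g (n + (K + 1))‖ := (Real.norm_eq_abs _).symm
      _ ≤ ∑' n, ‖g (n + (K + 1))‖ := norm_tsum_le_tsum_norm hsum_tail.norm
      _ ≤ ∑' n, 1 / ((n + (K + 1) : ℕ) : ℝ) ^ 2 := by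
          refine hsum_tail.norm.tsum_le_tsum (fun n => ?_) hsq_tail
          rw [Real.norm_eq_abs]
          exact abs_ite_moebius_div_sq_le _
      _ ≤ 1 / (K : ℝ) := hsqtail
  have heq : ∑ d ∈ Icc 1 K, g d - 8 / Real.pi ^ 2 = -∑' n, g (n + (K + 1)) := by linarith
  rw [heq, abs_neg]
  exact htail


/-! ### Counting `n ≡ a (mod 4)` in `(0, M]`, plain and with a square divisor -/

/-- For `a ∈ {1, 2, 3}`: `#{m ∈ (0, M] : m ≡ a (mod 4)} = ⌊(M + 4 − a)/4⌋`. [folklore] -/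
theorem card_Ioc_filter_mod_four_eq {a : ℕ} (ha0 : a ≠ 0) (ha4 : a < 4) (M : ℕ) :
    ((Ioc 0 M).filter (fun m => m % 4 = a)).card = (M + 4 - a) / 4 := by
  induction M with
  | zero =>
    rw [Finset.Ioc_self, Finset.filter_empty, Finset.card_empty]
    omega
  | succ M ih =>
    rw [← Finset.insert_Ioc_right_eq_Ioc_add_one (Nat.zero_le M), Finset.filter_insert]
    have hnot : M + 1 ∉ (Ioc 0 M).filter (fun m => m % 4 = a) := by simp
    split_ifs with h
    · rw [Finset.card_insert_of_notMem hnot, ih]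
      omega
    · rw [ih]
      omega

/-- For `a ∈ {1, 2, 3}`: `|#{m ∈ (0, M] : m ≡ a (mod 4)} − M/4| ≤ 1`. [folklore] -/
theorem abs_card_Ioc_filter_mod_four_sub_le {a : ℕ} (ha0 : a ≠ 0) (ha4 : a < 4) (M : ℕ) :
    |((((Ioc 0 M).filter (fun m => m % 4 = a)).card : ℕ) : ℝ) - (M : ℝ) / 4| ≤ 1 := by
  rw [card_Ioc_filter_mod_four_eq ha0 ha4]
  set q := (M + 4 - a) / 4 with hq
  have h1 : 4 * q ≤ M + 4 := by omega
  have h2 : M ≤ 4 * q + 4 := by omega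
  have h1' : (4 : ℝ) * q ≤ M + 4 := by exact_mod_cast h1
  have h2' : (M : ℝ) ≤ 4 * q + 4 := by exact_mod_cast h2
  rw [abs_le]
  constructor <;> linarith

/-- For odd `d`: `#{n ∈ (0, N] : d² ∣ n, n ≡ a (mod 4)} = #{m ∈ (0, N/d²] : m ≡ a (mod 4)}`
(`n = d² m` and `d² ≡ 1 (mod 4)`). [folklore] -/
theorem card_filter_sq_dvd_mod_four_of_odd {d : ℕ} (hd : d % 2 = 1) (a N : ℕ) :
    ((Ioc 0 N).filter (fun n => d ^ 2 ∣ n ∧ n % 4 = a)).card =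
      ((Ioc 0 (N / d ^ 2)).filter (fun m => m % 4 = a)).card := by
  have hd0 : 0 < d := by omega
  have hd2 : 0 < d ^ 2 := pow_pos hd0 2
  have hsq : d ^ 2 % 4 = 1 := by
    have h4 : d % 4 = 1 ∨ d % 4 = 3 := by omega
    rcases h4 with h | h <;> simp [Nat.pow_mod, h]
  symm
  rw [← Finset.card_map ⟨fun m => d ^ 2 * m, mul_right_injective₀ hd2.ne'⟩]
  congr 1
  ext n
  simp only [Finset.mem_map, Finset.mem_filter, Finset.mem_Ioc, Function.Embedding.coeFn_mk]
  constructor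
  · rintro ⟨m, ⟨⟨hm0, hmN⟩, hma⟩, rfl⟩
    refine ⟨⟨by positivity, ?_⟩, dvd_mul_right _ _, ?_⟩
    · calc d ^ 2 * m ≤ d ^ 2 * (N / d ^ 2) := Nat.mul_le_mul_left _ hmN
        _ ≤ N := Nat.mul_div_le N (d ^ 2)
    · rw [Nat.mul_mod, hsq, one_mul, Nat.mod_mod, hma]
  · rintro ⟨⟨hn0, hnN⟩, ⟨m, rfl⟩, hna⟩
    refine ⟨m, ⟨⟨Nat.pos_of_mul_pos_left hn0, ?_⟩, ?_⟩, rfl⟩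
    · exact (Nat.le_div_iff_mul_le hd2).2 (by rw [mul_comm]; exact hnN)
    · rw [Nat.mul_mod, hsq, one_mul, Nat.mod_mod] at hna
      exact hna

/-- For even `d` and `a ≢ 0 (mod 4)`: no `n ≡ a (mod 4)` is divisible by `d²` (as `4 ∣ d²`).
[folklore] -/
theorem card_filter_sq_dvd_mod_four_of_even {d : ℕ} (hd : d % 2 = 0) {a : ℕ} (ha : a % 4 ≠ 0)
    (N : ℕ) : ((Ioc 0 N).filter (fun n => d ^ 2 ∣ n ∧ n % 4 = a)).card = 0 := by
  rw [Finset.card_eq_zero, Finset.filter_eq_empty_iff]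
  rintro n - ⟨hdn, hna⟩
  obtain ⟨e, rfl⟩ : 2 ∣ d := Nat.dvd_of_mod_eq_zero hd
  have h4 : 4 ∣ n := (Dvd.intro (e ^ 2) (by ring) : 4 ∣ (2 * e) ^ 2).trans hdn
  omega

/-- If `d² > N` then no `n ∈ (0, N]` is divisible by `d²`. [folklore] -/
theorem card_filter_sq_dvd_mod_four_of_lt {d N : ℕ} (hd : N < d ^ 2) (a : ℕ) :
    ((Ioc 0 N).filter (fun n => d ^ 2 ∣ n ∧ n % 4 = a)).card = 0 := by
  rw [Finset.card_eq_zero, Finset.filter_eq_empty_iff]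
  rintro n hn ⟨hdn, -⟩
  rw [mem_Ioc] at hn
  exact absurd (Nat.le_of_dvd hn.1 hdn) (by omega)

/-! ### Squarefree integers in a residue class mod `4` -/

/-- **Möbius inversion for the count**:
`#{n ∈ (0, N] : n squarefree, n ≡ a (4)} = Σ_{1 ≤ d ≤ N} μ(d) · #{n ∈ (0, N] : d² ∣ n, n ≡ a (4)}`.
[folklore] -/
theorem card_squarefree_mod_four_eq_sum (a N : ℕ) :
    ((((Ioc 0 N).filter (fun n => Squarefree n ∧ n % 4 = a)).card : ℕ) : ℝ) =
      ∑ d ∈ Icc 1 N, (μ d : ℝ) *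
        (((Ioc 0 N).filter (fun n => d ^ 2 ∣ n ∧ n % 4 = a)).card : ℝ) := by
  classical
  set A := (Ioc 0 N).filter (fun n => n % 4 = a) with hA
  have hfilt : (Ioc 0 N).filter (fun n => Squarefree n ∧ n % 4 = a) = A.filter Squarefree := by
    ext n
    simp only [hA, mem_filter]
    tauto
  have hfilt' : ∀ d : ℕ, (Ioc 0 N).filter (fun n => d ^ 2 ∣ n ∧ n % 4 = a) =
      A.filter (fun n => d ^ 2 ∣ n) := by
    intro d
    ext n
    simp only [hA, mem_filter]
    tauto
  have hL : ((((Ioc 0 N).filter (fun n => Squarefree n ∧ n % 4 = a)).card : ℕ) : ℝ) =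
      ∑ n ∈ A, (if Squarefree n then (1 : ℝ) else 0) := by
    rw [Finset.sum_boole, hfilt]
  rw [hL]
  have hinner : ∀ n ∈ A, (if Squarefree n then (1 : ℝ) else 0) =
      ∑ d ∈ Icc 1 N, (if d ^ 2 ∣ n then (μ d : ℝ) else 0) := by
    intro n hn
    have hn' : n ∈ Ioc 0 N := Finset.mem_of_mem_filter n hn
    rw [mem_Ioc] at hn'
    rw [← sum_moebius_filter_sq_dvd_eq hn'.1 hn'.2, Finset.sum_filter]
  rw [Finset.sum_congr rfl hinner, Finset.sum_comm]
  refine Finset.sum_congr rfl fun d _ => ?_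
  rw [← Finset.sum_filter, Finset.sum_const, nsmul_eq_mul, mul_comm, hfilt' d]

/-- **Squarefree integers are equidistributed in the classes `1, 2, 3 (mod 4)` with density `2/π²`
each, error `3√N`**: for `a ∈ {1, 2, 3}` and every `N`,
`|#{n ∈ (0, N] : n squarefree, n ≡ a (mod 4)} − (2/π²) N| ≤ 3 √N`.
(Möbius inversion; only odd `d ≤ √N` contribute, each `μ(d)(N/(4d²) + O(1))`, and
`Σ_{d odd} μ(d)/d² = 8/π²` with tail `≤ 1/√N`.) This is the case `m = 4` of the count of
squarefree numbers in progressions behind Taniguchi–Thorne's Lemma 21 and BTT's Lemma 8.1.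
[folklore] -/
theorem abs_card_squarefree_mod_four_sub_le {a : ℕ} (ha0 : a ≠ 0) (ha4 : a < 4) (N : ℕ) :
    |((((Ioc 0 N).filter (fun n => Squarefree n ∧ n % 4 = a)).card : ℕ) : ℝ)
        - 2 / Real.pi ^ 2 * N| ≤ 3 * Real.sqrt N := by
  rcases Nat.eq_zero_or_pos N with rfl | hN
  · simp
  set K := Nat.sqrt N with hK
  have hK1 : 1 ≤ K := Nat.sqrt_pos.mpr hN
  set c : ℕ → ℝ := fun d => (((Ioc 0 N).filter (fun n => d ^ 2 ∣ n ∧ n % 4 = a)).card : ℝ)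
    with hc
  set g : ℕ → ℝ := fun d => if d % 2 = 1 then (μ d : ℝ) / (d : ℝ) ^ 2 else 0 with hg
  -- the count as a Möbius sum over `d ≤ √N`
  have hS : ((((Ioc 0 N).filter (fun n => Squarefree n ∧ n % 4 = a)).card : ℕ) : ℝ) =
      ∑ d ∈ Icc 1 K, (μ d : ℝ) * c d := by
    rw [card_squarefree_mod_four_eq_sum]
    symm
    refine Finset.sum_subset (Icc_subset_Icc le_rfl (Nat.sqrt_le_self N)) fun d hdN hdK => ?_
    rw [mem_Icc] at hdN hdK
    have hlt : Nat.sqrt N < d := by omega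
    simp only [hc]
    rw [card_filter_sq_dvd_mod_four_of_lt (Nat.sqrt_lt'.mp hlt) a, Nat.cast_zero, mul_zero]
  -- termwise comparison with `(N/4) g(d)`
  have hterm : ∀ d ∈ Icc 1 K, |(μ d : ℝ) * c d - (N : ℝ) / 4 * g d| ≤ 2 := by
    intro d hd
    rw [mem_Icc] at hd
    by_cases hodd : d % 2 = 1
    · simp only [hg, hc, if_pos hodd]
      rw [card_filter_sq_dvd_mod_four_of_odd hodd]
      have h1 := abs_card_Ioc_filter_mod_four_sub_le ha0 ha4 (N / d ^ 2)
      have hd0 : (0 : ℝ) < d := by exact_mod_cast hd.1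
      have hd2 : (0 : ℝ) < (d : ℝ) ^ 2 := by positivity
      have hM1 : (((N / d ^ 2 : ℕ) : ℕ) : ℝ) ≤ (N : ℝ) / (d : ℝ) ^ 2 := by
        have := (Nat.cast_div_le (m := N) (n := d ^ 2) (α := ℝ))
        push_cast at this
        exact this
      have hM2 : (N : ℝ) / (d : ℝ) ^ 2 ≤ ((N / d ^ 2 : ℕ) : ℝ) + 1 := by
        have h := Nat.lt_div_mul_add (a := N) (pow_pos hd.1 2)
        have h' : (N : ℝ) < ((N / d ^ 2 : ℕ) : ℝ) * (d : ℝ) ^ 2 + (d : ℝ) ^ 2 := by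
          exact_mod_cast h
        rw [div_le_iff₀ hd2]
        linarith
      have hμ : |(μ d : ℝ)| ≤ 1 := by exact_mod_cast ArithmeticFunction.abs_moebius_le_one
      have hdiff : |(((Ioc 0 (N / d ^ 2)).filter (fun m => m % 4 = a)).card : ℝ)
          - (N : ℝ) / (d : ℝ) ^ 2 / 4| ≤ 5 / 4 := by
        have := abs_le.mp h1
        rw [abs_le]
        constructor <;> linarith
      calc |(μ d : ℝ) * (((Ioc 0 (N / d ^ 2)).filter (fun m => m % 4 = a)).card : ℝ)
              - (N : ℝ) / 4 * ((μ d : ℝ) / (d : ℝ) ^ 2)|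
            = |(μ d : ℝ)| * |(((Ioc 0 (N / d ^ 2)).filter (fun m => m % 4 = a)).card : ℝ)
                - (N : ℝ) / (d : ℝ) ^ 2 / 4| := by
              rw [← abs_mul]
              congr 1
              field_simp
        _ ≤ 1 * (5 / 4) := mul_le_mul hμ hdiff (abs_nonneg _) zero_le_one
        _ ≤ 2 := by norm_num
    · have heven : d % 2 = 0 := by omega
      simp only [hg, hc, if_neg hodd]
      rw [card_filter_sq_dvd_mod_four_of_even heven (by omega : a % 4 ≠ 0), Nat.cast_zero]
      norm_num
  have hsum : |∑ d ∈ Icc 1 K, (μ d : ℝ) * c d - (N : ℝ) / 4 * ∑ d ∈ Icc 1 K, g d| ≤ 2 * K := by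
    rw [Finset.mul_sum, ← Finset.sum_sub_distrib]
    calc |∑ d ∈ Icc 1 K, ((μ d : ℝ) * c d - (N : ℝ) / 4 * g d)|
          ≤ ∑ d ∈ Icc 1 K, |(μ d : ℝ) * c d - (N : ℝ) / 4 * g d| := abs_sum_le_sum_abs _ _
      _ ≤ ∑ d ∈ Icc 1 K, (2 : ℝ) := sum_le_sum hterm
      _ = 2 * K := by
          rw [sum_const, Nat.card_Icc, nsmul_eq_mul]
          push_cast
          ring
  have htail : |∑ d ∈ Icc 1 K, g d - 8 / Real.pi ^ 2| ≤ 1 / (K : ℝ) :=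
    abs_sum_ite_moebius_div_sq_sub_le hK1
  have hKreal : (K : ℝ) ≤ Real.sqrt N := by
    have h := Nat.sqrt_le' N
    rw [show (K : ℝ) = Real.sqrt ((K : ℝ) ^ 2) by rw [Real.sqrt_sq (Nat.cast_nonneg K)]]
    exact Real.sqrt_le_sqrt (by exact_mod_cast h)
  have hK0 : (0 : ℝ) < K := by exact_mod_cast hK1
  have hNK : (N : ℝ) / 4 * (1 / (K : ℝ)) ≤ K := by
    have h := Nat.lt_succ_sqrt' N
    have h' : (N : ℝ) < ((K + 1 : ℕ) : ℝ) ^ 2 := by exact_mod_cast h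
    push_cast at h'
    have hK1' : (1 : ℝ) ≤ K := by exact_mod_cast hK1
    rw [show (N : ℝ) / 4 * (1 / (K : ℝ)) = (N : ℝ) / (4 * K) by field_simp, div_le_iff₀ (by positivity)]
    nlinarith
  rw [hS]
  calc |∑ d ∈ Icc 1 K, (μ d : ℝ) * c d - 2 / Real.pi ^ 2 * N|
        = |(∑ d ∈ Icc 1 K, (μ d : ℝ) * c d - (N : ℝ) / 4 * ∑ d ∈ Icc 1 K, g d)
            + (N : ℝ) / 4 * (∑ d ∈ Icc 1 K, g d - 8 / Real.pi ^ 2)| := by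
          congr 1
          ring
    _ ≤ |∑ d ∈ Icc 1 K, (μ d : ℝ) * c d - (N : ℝ) / 4 * ∑ d ∈ Icc 1 K, g d|
          + |(N : ℝ) / 4 * (∑ d ∈ Icc 1 K, g d - 8 / Real.pi ^ 2)| := abs_add_le _ _
    _ ≤ 2 * K + (N : ℝ) / 4 * (1 / (K : ℝ)) := by
          refine add_le_add hsum ?_
          rw [abs_mul, abs_of_nonneg (by positivity : (0 : ℝ) ≤ (N : ℝ) / 4)]
          exact mul_le_mul_of_nonneg_left htail (by positivity)
    _ ≤ 2 * Real.sqrt N + Real.sqrt N := add_le_add (by linarith) (hNK.trans hKreal)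
    _ = 3 * Real.sqrt N := by ring


/-! ### Fundamental discriminants as squarefree integers in residue classes mod `4` -/

/-- `Squarefree (-(n : ℤ)) ↔ Squarefree n`. [folklore] -/
theorem squarefree_neg_natCast {n : ℕ} : Squarefree (-(n : ℤ)) ↔ Squarefree n := by
  rw [← Int.squarefree_natAbs, Int.natAbs_neg, Int.natAbs_natCast]

/-- For `M : ℕ`: the squarefree `n ∈ (0, M]` with `n % 4 ∈ {b, c}` (`b ≠ c`) number
`S_b(M) + S_c(M)`. [folklore] -/
theorem card_filter_squarefree_mod_four_or {b c : ℕ} (hbc : b ≠ c) (M : ℕ) :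
    ((Ioc 0 M).filter (fun n => Squarefree n ∧ (n % 4 = b ∨ n % 4 = c))).card =
      ((Ioc 0 M).filter (fun n => Squarefree n ∧ n % 4 = b)).card +
        ((Ioc 0 M).filter (fun n => Squarefree n ∧ n % 4 = c)).card := by
  rw [← Finset.card_union_of_disjoint]
  · congr 1
    ext n
    simp only [mem_filter, mem_union]
    tauto
  · rw [Finset.disjoint_left]
    intro n hb hc
    rw [mem_filter] at hb hc
    exact hbc (hb.2.2.symm.trans hc.2.2)

/-- **The positive fundamental discriminants below `X`, sorted by residue mod `4`.**
`posFundDiscrs X` is the disjoint union of (the casts of) the squarefree `n ≡ 1 (mod 4)` in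
`(0, X − 1]` other than `1`, and of `4m` for the squarefree `m ≡ 2, 3 (mod 4)` in `(0, (X−1)/4]`.
[folklore] -/
theorem posFundDiscrs_eq_union (X : ℕ) :
    posFundDiscrs X =
      ((((Ioc 0 (X - 1)).filter (fun n => Squarefree n ∧ n % 4 = 1)).erase 1).map
          Nat.castEmbedding) ∪
      (((Ioc 0 ((X - 1) / 4)).filter (fun n => Squarefree n ∧ (n % 4 = 2 ∨ n % 4 = 3))).map
          ⟨fun n : ℕ => 4 * (n : ℤ), fun a b h => by exact_mod_cast (mul_right_injective₀
            (by norm_num : (4 : ℤ) ≠ 0) h : (a : ℤ) = b)⟩) := by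
  ext D
  simp only [mem_posFundDiscrs, mem_union, Finset.mem_map, mem_erase, mem_filter, mem_Ioc,
    Nat.castEmbedding_apply, Function.Embedding.coeFn_mk]
  constructor
  · rintro ⟨⟨h0, hX⟩, (⟨h1, hsq, hne⟩ | ⟨⟨E, rfl⟩, hmod, hsq⟩)⟩
    · obtain ⟨n, rfl⟩ := Int.eq_ofNat_of_zero_le h0.le
      refine Or.inl ⟨n, ⟨by exact_mod_cast hne, ⟨by omega, by omega⟩,
        Int.squarefree_natCast.mp hsq, by omega⟩, rfl⟩
    · have hE : 0 ≤ E := by omega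
      obtain ⟨m, rfl⟩ := Int.eq_ofNat_of_zero_le hE
      rw [Int.mul_ediv_cancel_left _ (by norm_num : (4 : ℤ) ≠ 0)] at hmod hsq
      refine Or.inr ⟨m, ⟨⟨by omega, by omega⟩, Int.squarefree_natCast.mp hsq, by omega⟩, rfl⟩
  · rintro (⟨n, ⟨hne, ⟨hn0, hnX⟩, hsq, hn1⟩, rfl⟩ | ⟨m, ⟨⟨hm0, hmX⟩, hsq, hmod⟩, rfl⟩)
    · refine ⟨⟨by omega, by omega⟩, Or.inl ⟨by omega, Int.squarefree_natCast.mpr hsq, ?_⟩⟩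
      exact_mod_cast hne
    · refine ⟨⟨by omega, by omega⟩, Or.inr ⟨dvd_mul_right 4 (m : ℤ), ?_, ?_⟩⟩
      · rw [Int.mul_ediv_cancel_left _ (by norm_num : (4 : ℤ) ≠ 0)]
        omega
      · rw [Int.mul_ediv_cancel_left _ (by norm_num : (4 : ℤ) ≠ 0)]
        exact Int.squarefree_natCast.mpr hsq

/-- **`#posFundDiscrs X` in terms of squarefree counts mod `4`**:
`#posFundDiscrs X = (S₁(X−1) − [2 ≤ X]) + S₂(⌊(X−1)/4⌋) + S₃(⌊(X−1)/4⌋)` where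
`S_a(M) = #{n ∈ (0, M] : n squarefree, n ≡ a (mod 4)}`; here as the equality with the `erase`d
first count. [folklore] -/
theorem card_posFundDiscrs_eq (X : ℕ) :
    (posFundDiscrs X).card =
      (((Ioc 0 (X - 1)).filter (fun n => Squarefree n ∧ n % 4 = 1)).erase 1).card +
      (((Ioc 0 ((X - 1) / 4)).filter (fun n => Squarefree n ∧ n % 4 = 2)).card +
        ((Ioc 0 ((X - 1) / 4)).filter (fun n => Squarefree n ∧ n % 4 = 3)).card) := by
  rw [posFundDiscrs_eq_union, Finset.card_union_of_disjoint, Finset.card_map, Finset.card_map,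
    card_filter_squarefree_mod_four_or (by norm_num : (2 : ℕ) ≠ 3)]
  rw [Finset.disjoint_left]
  rintro D h1 h4
  simp only [Finset.mem_map, mem_erase, mem_filter, Nat.castEmbedding_apply,
    Function.Embedding.coeFn_mk] at h1 h4
  obtain ⟨n, ⟨-, -, -, hn1⟩, rfl⟩ := h1
  obtain ⟨m, -, hm⟩ := h4
  omega

/-- **The negative fundamental discriminants above `−X`, sorted by residue mod `4`.**
`negFundDiscrs X` is the disjoint union of `−n` for the squarefree `n ≡ 3 (mod 4)` in `(0, X − 1]`
and of `−4m` for the squarefree `m ≡ 1, 2 (mod 4)` in `(0, (X−1)/4]`. [folklore] -/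
theorem negFundDiscrs_eq_union (X : ℕ) :
    negFundDiscrs X =
      (((Ioc 0 (X - 1)).filter (fun n => Squarefree n ∧ n % 4 = 3)).map
          ⟨fun n : ℕ => -(n : ℤ), fun a b h => by exact_mod_cast neg_injective h⟩) ∪
      (((Ioc 0 ((X - 1) / 4)).filter (fun n => Squarefree n ∧ (n % 4 = 2 ∨ n % 4 = 1))).map
          ⟨fun n : ℕ => 4 * (-(n : ℤ)), fun a b h => by
            have := mul_right_injective₀ (by norm_num : (4 : ℤ) ≠ 0) h
            exact_mod_cast neg_injective this⟩) := by
  ext D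
  simp only [mem_negFundDiscrs, mem_union, Finset.mem_map, mem_filter, mem_Ioc,
    Function.Embedding.coeFn_mk]
  constructor
  · rintro ⟨⟨hX, h0⟩, (⟨h1, hsq, -⟩ | ⟨⟨E, rfl⟩, hmod, hsq⟩)⟩
    · obtain ⟨n, hn⟩ := Int.eq_ofNat_of_zero_le (by omega : 0 ≤ -D)
      have hD : D = -(n : ℤ) := by omega
      subst hD
      refine Or.inl ⟨n, ⟨⟨by omega, by omega⟩, squarefree_neg_natCast.mp hsq, by omega⟩, rfl⟩
    · obtain ⟨m, hm⟩ := Int.eq_ofNat_of_zero_le (by omega : 0 ≤ -E)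
      have hE : E = -(m : ℤ) := by omega
      subst hE
      rw [Int.mul_ediv_cancel_left _ (by norm_num : (4 : ℤ) ≠ 0)] at hmod hsq
      refine Or.inr ⟨m, ⟨⟨by omega, by omega⟩, squarefree_neg_natCast.mp hsq, by omega⟩, rfl⟩
  · rintro (⟨n, ⟨⟨hn0, hnX⟩, hsq, hn3⟩, rfl⟩ | ⟨m, ⟨⟨hm0, hmX⟩, hsq, hmod⟩, rfl⟩)
    · exact ⟨⟨by omega, by omega⟩, Or.inl ⟨by omega, squarefree_neg_natCast.mpr hsq, by omega⟩⟩
    · refine ⟨⟨by omega, by omega⟩, Or.inr ⟨dvd_mul_right 4 _, ?_, ?_⟩⟩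
      · rw [Int.mul_ediv_cancel_left _ (by norm_num : (4 : ℤ) ≠ 0)]
        omega
      · rw [Int.mul_ediv_cancel_left _ (by norm_num : (4 : ℤ) ≠ 0)]
        exact squarefree_neg_natCast.mpr hsq

/-- **`#negFundDiscrs X` in terms of squarefree counts mod `4`**:
`#negFundDiscrs X = S₃(X−1) + S₂(⌊(X−1)/4⌋) + S₁(⌊(X−1)/4⌋)`. [folklore] -/
theorem card_negFundDiscrs_eq (X : ℕ) :
    (negFundDiscrs X).card =
      ((Ioc 0 (X - 1)).filter (fun n => Squarefree n ∧ n % 4 = 3)).card +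
      (((Ioc 0 ((X - 1) / 4)).filter (fun n => Squarefree n ∧ n % 4 = 2)).card +
        ((Ioc 0 ((X - 1) / 4)).filter (fun n => Squarefree n ∧ n % 4 = 1)).card) := by
  rw [negFundDiscrs_eq_union, Finset.card_union_of_disjoint, Finset.card_map, Finset.card_map,
    card_filter_squarefree_mod_four_or (by norm_num : (2 : ℕ) ≠ 1)]
  rw [Finset.disjoint_left]
  rintro D h1 h4
  simp only [Finset.mem_map, mem_filter, Function.Embedding.coeFn_mk] at h1 h4
  obtain ⟨n, ⟨-, -, hn3⟩, rfl⟩ := h1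
  obtain ⟨m, -, hm⟩ := h4
  omega

/-! ### `N₂^±(X) = (3/π²) X + O(√X)` -/

/-- The bookkeeping step common to both signs: from the three residue-class counts at `X − 1`
and `⌊(X−1)/4⌋` (each `(2/π²)·length + O(3√·)`) and a first count known up to `1`, the total is
`(3/π²) X + O(8√X)`. [folklore] -/
theorem abs_sum_three_counts_sub_le {X : ℕ} (hX : 1 ≤ X) {s A B C : ℝ}
    (hs : A - 1 ≤ s ∧ s ≤ A)
    (hA : |A - 2 / Real.pi ^ 2 * ((X - 1 : ℕ) : ℝ)| ≤ 3 * Real.sqrt ((X - 1 : ℕ) : ℝ))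
    (hB : |B - 2 / Real.pi ^ 2 * (((X - 1) / 4 : ℕ) : ℝ)| ≤ 3 * Real.sqrt (((X - 1) / 4 : ℕ) : ℝ))
    (hC : |C - 2 / Real.pi ^ 2 * (((X - 1) / 4 : ℕ) : ℝ)| ≤ 3 * Real.sqrt (((X - 1) / 4 : ℕ) : ℝ)) :
    |s + (B + C) - 3 / Real.pi ^ 2 * X| ≤ 8 * Real.sqrt X := by
  set M : ℕ := (X - 1) / 4 with hM
  have hX1 : ((X - 1 : ℕ) : ℝ) = (X : ℝ) - 1 := by push_cast [Nat.cast_sub hX]; ring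
  have h4M : 4 * M ≤ X - 1 := Nat.mul_div_le (X - 1) 4
  have h4M' : X ≤ 4 * M + 4 := by omega
  have hMle : (4 : ℝ) * M ≤ X - 1 := by rw [← hX1]; exact_mod_cast h4M
  have hMge : (X : ℝ) ≤ 4 * M + 4 := by exact_mod_cast h4M'
  have hX1' : (1 : ℝ) ≤ X := by exact_mod_cast hX
  have hsqX1 : (1 : ℝ) ≤ Real.sqrt X := by
    rw [show (1 : ℝ) = Real.sqrt 1 by rw [Real.sqrt_one]]
    exact Real.sqrt_le_sqrt hX1'
  have hsq1 : Real.sqrt ((X - 1 : ℕ) : ℝ) ≤ Real.sqrt X :=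
    Real.sqrt_le_sqrt (by rw [hX1]; linarith)
  have hsqM : Real.sqrt (M : ℝ) * 2 ≤ Real.sqrt X := by
    calc Real.sqrt (M : ℝ) * 2 = Real.sqrt M * Real.sqrt (2 ^ 2) := by
          rw [Real.sqrt_sq (by norm_num)]
      _ = Real.sqrt ((M : ℝ) * 2 ^ 2) := (Real.sqrt_mul (Nat.cast_nonneg M) _).symm
      _ ≤ Real.sqrt X := Real.sqrt_le_sqrt (by linarith)
  have hpi : (9 : ℝ) ≤ Real.pi ^ 2 := by
    have := Real.pi_gt_three
    nlinarith
  -- the main terms combine to `(3/π²) X` up to `6/π² < 1`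
  have hmain : |2 / Real.pi ^ 2 * ((X - 1 : ℕ) : ℝ) + 2 / Real.pi ^ 2 * (M : ℝ)
      + 2 / Real.pi ^ 2 * (M : ℝ) - 3 / Real.pi ^ 2 * (X : ℝ)| ≤ 1 := by
    rw [hX1, show 2 / Real.pi ^ 2 * ((X : ℝ) - 1) + 2 / Real.pi ^ 2 * (M : ℝ)
      + 2 / Real.pi ^ 2 * (M : ℝ) - 3 / Real.pi ^ 2 * (X : ℝ) = (4 * M - X - 2) / Real.pi ^ 2 by ring,
      abs_div, abs_of_pos (by positivity : (0 : ℝ) < Real.pi ^ 2), div_le_one (by positivity)]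
    have : |(4 : ℝ) * M - X - 2| ≤ 6 := by rw [abs_le]; constructor <;> linarith
    linarith
  have key : s + (B + C) - 3 / Real.pi ^ 2 * X =
      (s - A) + (A - 2 / Real.pi ^ 2 * ((X - 1 : ℕ) : ℝ)) + (B - 2 / Real.pi ^ 2 * (M : ℝ))
        + (C - 2 / Real.pi ^ 2 * (M : ℝ))
        + (2 / Real.pi ^ 2 * ((X - 1 : ℕ) : ℝ) + 2 / Real.pi ^ 2 * (M : ℝ)
            + 2 / Real.pi ^ 2 * (M : ℝ) - 3 / Real.pi ^ 2 * (X : ℝ)) := by ring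
  have hA' := abs_le.mp hA
  have hB' := abs_le.mp hB
  have hC' := abs_le.mp hC
  have hm' := abs_le.mp hmain
  have h0M := Real.sqrt_nonneg (M : ℝ)
  have h01 := Real.sqrt_nonneg ((X - 1 : ℕ) : ℝ)
  rw [key, abs_le]
  constructor
  · linarith [hs.1, hA'.1, hB'.1, hC'.1, hm'.1]
  · linarith [hs.2, hA'.2, hB'.2, hC'.2, hm'.2]

/-- **The number of real quadratic fields of discriminant `< X` is `(3/π²) X + O(√X)`**
(BTT Prop. 4.2 with no local conditions, `+` sign; Taniguchi–Thorne Lemma 21 at `m = 1`):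
`|#posFundDiscrs X − (3/π²) X| ≤ 8 √X` for every `X`.
[cite: BhargavaTaniguchiThorne2023, Proposition 4.2] -/
theorem abs_card_posFundDiscrs_sub_le (X : ℕ) :
    |((posFundDiscrs X).card : ℝ) - 3 / Real.pi ^ 2 * X| ≤ 8 * Real.sqrt X := by
  rcases Nat.eq_zero_or_pos X with rfl | hX
  · have h0 : posFundDiscrs 0 = ∅ := by
      rw [Finset.eq_empty_iff_forall_notMem]
      intro D hD
      rw [mem_posFundDiscrs] at hD
      omega
    simp [h0]
  rw [card_posFundDiscrs_eq]
  push_cast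
  set F₁ := (Ioc 0 (X - 1)).filter (fun n => Squarefree n ∧ n % 4 = 1) with hF₁
  have hs : ((F₁.card : ℕ) : ℝ) - 1 ≤ ((F₁.erase 1).card : ℝ) ∧
      ((F₁.erase 1).card : ℝ) ≤ (F₁.card : ℝ) := by
    by_cases h1 : (1 : ℕ) ∈ F₁
    · have hpos : 1 ≤ F₁.card := Finset.card_pos.mpr ⟨1, h1⟩
      rw [Finset.card_erase_of_mem h1, Nat.cast_sub hpos]
      constructor <;> simp
    · rw [Finset.erase_eq_of_notMem h1]
      constructor <;> linarith
  exact abs_sum_three_counts_sub_le hX hs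
    (abs_card_squarefree_mod_four_sub_le one_ne_zero (by norm_num) (X - 1))
    (abs_card_squarefree_mod_four_sub_le two_ne_zero (by norm_num) ((X - 1) / 4))
    (abs_card_squarefree_mod_four_sub_le (by norm_num) (by norm_num) ((X - 1) / 4))

/-- **The number of imaginary quadratic fields of discriminant `> −X` is `(3/π²) X + O(√X)`**
(BTT Prop. 4.2 with no local conditions, `−` sign; Taniguchi–Thorne Lemma 21 at `m = 1`):
`|#negFundDiscrs X − (3/π²) X| ≤ 8 √X` for every `X`.
[cite: BhargavaTaniguchiThorne2023, Proposition 4.2] -/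
theorem abs_card_negFundDiscrs_sub_le (X : ℕ) :
    |((negFundDiscrs X).card : ℝ) - 3 / Real.pi ^ 2 * X| ≤ 8 * Real.sqrt X := by
  rcases Nat.eq_zero_or_pos X with rfl | hX
  · have h0 : negFundDiscrs 0 = ∅ := by
      rw [Finset.eq_empty_iff_forall_notMem]
      intro D hD
      rw [mem_negFundDiscrs] at hD
      omega
    simp [h0]
  rw [card_negFundDiscrs_eq]
  push_cast
  refine abs_sum_three_counts_sub_le hX ⟨by linarith, le_rfl⟩
    (abs_card_squarefree_mod_four_sub_le (by norm_num) (by norm_num) (X - 1))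
    (abs_card_squarefree_mod_four_sub_le two_ne_zero (by norm_num) ((X - 1) / 4))
    (abs_card_squarefree_mod_four_sub_le one_ne_zero (by norm_num) ((X - 1) / 4))


/-! ### Consistency of the vendored constants: BTT Thm 1.2 implies the Davenport–Heilbronn means -/

/-- Abstract two-term-asymptotic-to-mean step: if `|S(X) − cX − K X^{5/6}| ≤ C₁ X^{3/4}` for
`X ≥ 1` and `|N(X) − dX| ≤ C₂ √X` with `d > 0`, then `S(X)/N(X) → c/d`. [folklore] -/
theorem tendsto_div_of_two_term_asymptotics {S N : ℕ → ℝ} {c d K C₁ C₂ : ℝ} (hd : 0 < d)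
    (hS : ∀ X : ℕ, 1 ≤ X →
      |S X - c * X - K * (X : ℝ) ^ ((5 : ℝ) / 6)| ≤ C₁ * (X : ℝ) ^ ((3 : ℝ) / 4))
    (hN : ∀ X : ℕ, |N X - d * X| ≤ C₂ * Real.sqrt X) :
    Tendsto (fun X : ℕ => S X / N X) atTop (𝓝 (c / d)) := by
  have hpow : ∀ y : ℝ, 0 < y → Tendsto (fun X : ℕ => (X : ℝ) ^ (-y)) atTop (𝓝 0) := fun y hy =>
    (tendsto_rpow_neg_atTop hy).comp tendsto_natCast_atTop_atTop
  -- `S X / X → c`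
  have h1 : Tendsto (fun X : ℕ => S X / X) atTop (𝓝 c) := by
    have hb : Tendsto (fun X : ℕ => |C₁| * (X : ℝ) ^ (-(1 / 4 : ℝ)) + |K| * (X : ℝ) ^ (-(1 / 6 : ℝ)))
        atTop (𝓝 0) := by
      simpa using ((hpow _ (by norm_num : (0 : ℝ) < 1 / 4)).const_mul |C₁|).add
        ((hpow _ (by norm_num : (0 : ℝ) < 1 / 6)).const_mul |K|)
    rw [tendsto_iff_norm_sub_tendsto_zero]
    refine squeeze_zero_norm' ?_ hb
    filter_upwards [eventually_ge_atTop 1] with X hX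
    rw [norm_norm, Real.norm_eq_abs]
    have hX0 : (0 : ℝ) < X := by exact_mod_cast hX
    have hXne : (X : ℝ) ≠ 0 := hX0.ne'
    have key : S X / X - c = (S X - c * X - K * (X : ℝ) ^ ((5 : ℝ) / 6)) / X
        + K * (X : ℝ) ^ (-(1 / 6 : ℝ)) := by
      rw [show (-(1 / 6 : ℝ)) = (5 : ℝ) / 6 - 1 by norm_num, Real.rpow_sub_one hXne]
      field_simp
      ring
    have h34 : (X : ℝ) ^ ((3 : ℝ) / 4) / X = (X : ℝ) ^ (-(1 / 4 : ℝ)) := by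
      rw [show (-(1 / 4 : ℝ)) = (3 : ℝ) / 4 - 1 by norm_num, Real.rpow_sub_one hXne]
    rw [key]
    calc |(S X - c * X - K * (X : ℝ) ^ ((5 : ℝ) / 6)) / X + K * (X : ℝ) ^ (-(1 / 6 : ℝ))|
        ≤ |(S X - c * X - K * (X : ℝ) ^ ((5 : ℝ) / 6)) / X| + |K * (X : ℝ) ^ (-(1 / 6 : ℝ))| :=
          abs_add_le _ _
      _ ≤ C₁ * (X : ℝ) ^ ((3 : ℝ) / 4) / X + |K| * (X : ℝ) ^ (-(1 / 6 : ℝ)) := by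
          refine add_le_add ?_ ?_
          · rw [abs_div, abs_of_pos hX0]
            exact div_le_div_of_nonneg_right (hS X hX) hX0.le
          · rw [abs_mul, abs_of_nonneg (Real.rpow_nonneg hX0.le _)]
      _ ≤ |C₁| * (X : ℝ) ^ (-(1 / 4 : ℝ)) + |K| * (X : ℝ) ^ (-(1 / 6 : ℝ)) := by
          rw [mul_div_assoc, h34]
          refine add_le_add ?_ le_rfl
          exact mul_le_mul_of_nonneg_right (le_abs_self C₁) (Real.rpow_nonneg hX0.le _)
  -- `N X / X → d`
  have h2 : Tendsto (fun X : ℕ => N X / X) atTop (𝓝 d) := by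
    have hb : Tendsto (fun X : ℕ => |C₂| * (X : ℝ) ^ (-(1 / 2 : ℝ))) atTop (𝓝 0) := by
      simpa using (hpow _ (by norm_num : (0 : ℝ) < 1 / 2)).const_mul |C₂|
    rw [tendsto_iff_norm_sub_tendsto_zero]
    refine squeeze_zero_norm' ?_ hb
    filter_upwards [eventually_ge_atTop 1] with X hX
    rw [norm_norm, Real.norm_eq_abs]
    have hX0 : (0 : ℝ) < X := by exact_mod_cast hX
    have hXne : (X : ℝ) ≠ 0 := hX0.ne'
    have key : N X / X - d = (N X - d * X) / X := by
      field_simp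
    have h12 : Real.sqrt X / X = (X : ℝ) ^ (-(1 / 2 : ℝ)) := by
      rw [Real.sqrt_eq_rpow, show (-(1 / 2 : ℝ)) = (1 : ℝ) / 2 - 1 by norm_num,
        Real.rpow_sub_one hXne]
    rw [key, abs_div, abs_of_pos hX0]
    calc |N X - d * X| / X ≤ C₂ * Real.sqrt X / X := div_le_div_of_nonneg_right (hN X) hX0.le
      _ ≤ |C₂| * (X : ℝ) ^ (-(1 / 2 : ℝ)) := by
          rw [mul_div_assoc, h12]
          exact mul_le_mul_of_nonneg_right (le_abs_self C₂) (Real.rpow_nonneg hX0.le _)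
  have h3 := h1.div h2 hd.ne'
  refine h3.congr' ?_
  filter_upwards [eventually_ge_atTop 1] with X hX
  have hXne : (X : ℝ) ≠ 0 := by
    have : (0 : ℝ) < X := by exact_mod_cast hX
    exact this.ne'
  exact div_div_div_cancel_right₀ hXne (S X) (N X)

/-- **BTT Thm 1.2 implies Davenport–Heilbronn / BST Cor. 7, with the tree's constants**: the
two-term asymptotics `Σ_{-X<D<0} #Cl₃(D) = (6/π²) X + K⁻ X^{5/6} + O(X^{2/3+ε})`,
`Σ_{0<D<X} #Cl₃(D) = (4/π²) X + K⁺ X^{5/6} + O(X^{2/3+ε})` (`btt_threeTorsion_sum`) and the PROVED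
counts `#{0 < ±D < X fundamental} = (3/π²) X + O(√X)` (`abs_card_negFundDiscrs_sub_le`,
`abs_card_posFundDiscrs_sub_le`) give the means `2 = (6/π²)/(3/π²)` over imaginary and
`4/3 = (4/π²)/(3/π²)` over real quadratic fields (`bst_threeTorsion_mean`). In particular the
main-term constants vendored in the two facts are mutually consistent.
[cite: BhargavaTaniguchiThorne2023, Theorem 1.2] -/
theorem bst_threeTorsion_mean_of_btt_threeTorsion_sum (h : btt_threeTorsion_sum) :
    bst_threeTorsion_mean := by
  obtain ⟨⟨K₁, hK₁⟩, ⟨K₂, hK₂⟩⟩ := h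
  obtain ⟨C₁, hC₁⟩ := hK₁ (1 / 12) (by norm_num)
  obtain ⟨C₂, hC₂⟩ := hK₂ (1 / 12) (by norm_num)
  have he : (2 : ℝ) / 3 + 1 / 12 = 3 / 4 := by norm_num
  simp only [he] at hC₁ hC₂
  have hpi : (0 : ℝ) < 3 / Real.pi ^ 2 := by positivity
  constructor
  · have h1 := tendsto_div_of_two_term_asymptotics (c := 6 / Real.pi ^ 2) hpi hC₁
      abs_card_negFundDiscrs_sub_le
    rwa [show (6 / Real.pi ^ 2) / (3 / Real.pi ^ 2) = (2 : ℝ) by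
      field_simp; norm_num] at h1
  · have h2 := tendsto_div_of_two_term_asymptotics (c := 4 / Real.pi ^ 2) hpi hC₂
      abs_card_posFundDiscrs_sub_le
    rwa [show (4 / Real.pi ^ 2) / (3 / Real.pi ^ 2) = (4 / 3 : ℝ) by
      field_simp] at h2

/-! ### Discharge of `fundDiscrs_card_asymp` (BST §8.5, "Since it is known that …") -/

/-- From `|F(X) − (3/π²) X| ≤ 8 √X` for all `X`: `F(X)/X → 3/π²` (the `O(√X)` count gives the
first-order density; `√X ≤ X^{3/4}` for `X ≥ 1` and `tendsto_div_of_two_term_asymptotics` with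
`K = 0`, `N(X) = X`). [folklore] -/
theorem tendsto_div_natCast_of_abs_sub_le_eight_sqrt {F : ℕ → ℝ}
    (hF : ∀ X : ℕ, |F X - 3 / Real.pi ^ 2 * X| ≤ 8 * Real.sqrt X) :
    Tendsto (fun X : ℕ => F X / X) atTop (𝓝 (3 / Real.pi ^ 2)) := by
  have h := tendsto_div_of_two_term_asymptotics (S := F) (N := fun X : ℕ => (X : ℝ))
    (c := 3 / Real.pi ^ 2) (d := 1) (K := 0) (C₁ := 8) (C₂ := 0) one_pos ?_ ?_
  · simpa using h
  · intro X hX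
    have hx : (1 : ℝ) ≤ X := by exact_mod_cast hX
    have hsqrt : Real.sqrt X ≤ (X : ℝ) ^ ((3 : ℝ) / 4) := by
      rw [Real.sqrt_eq_rpow]
      exact Real.rpow_le_rpow_of_exponent_le hx (by norm_num)
    rw [zero_mul, sub_zero]
    exact (hF X).trans (by nlinarith)
  · intro X
    simp

/-- **DISCHARGE of `fundDiscrs_card_asymp`** — the number of quadratic fields of each sign with
`|D| < X` is `~ 3X/π²` (Bhargava–Shankar–Tsimerman §8.5: "Since it is known that
`lim Σ_{0<Disc(K₂)<X} 1 / X = 3/π²`, `lim Σ_{-X<Disc(K₂)<0} 1 / X = 3/π²`"): immediate from the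
PROVED counts with error `O(√X)`, `abs_card_negFundDiscrs_sub_le` and `abs_card_posFundDiscrs_sub_le`
(BTT Prop. 4.2 with no local conditions).
[cite: BhargavaShankarTsimerman2012, §8.5 (display "Since it is known that", proof of Cor. 7)]
[cite: BhargavaTaniguchiThorne2023, Proposition 4.2] -/
theorem fundDiscrs_card_asymp_holds : fundDiscrs_card_asymp :=
  ⟨tendsto_div_natCast_of_abs_sub_le_eight_sqrt abs_card_negFundDiscrs_sub_le,
    tendsto_div_natCast_of_abs_sub_le_eight_sqrt abs_card_posFundDiscrs_sub_le⟩

/-- Hence BST Cor. 7 (`bst_threeTorsion_mean`) needs only the first-order sum asymptotics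
`davenportHeilbronn_threeTorsion_sum_asymp` (the assembly `bst_threeTorsion_mean_holds_of` with its
first input discharged). [cite: BhargavaShankarTsimerman2012, §8.5 (proof of Cor. 7)] -/
theorem bst_threeTorsion_mean_of_sum_asymp (hS : davenportHeilbronn_threeTorsion_sum_asymp) :
    bst_threeTorsion_mean :=
  bst_threeTorsion_mean_holds_of fundDiscrs_card_asymp_holds hS

end Literature.NumberTheory.QuadraticFields
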